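import Summits.Ventures.QEC.Census.FoldTowerData288
import Summits.Ventures.QEC.Census.BB.BB288Data
import Summits.Ventures.QEC.Census.CertScan
import HarnessLib

/-!
# Fold certificate of `[[288,12,18]]` — TOP: from «every weight ≤ 16 word of ker H^X is a `T288` class» to the flat bound

Cell `qec`, row type-11 (kernel C). Two kernel-checked identities tie the torus-flat code `C288` of `FoldDefs` to
type-02's certificate words (`Census.bb288HX`, `Census.bb288HZ`, themselves kernel-checked equal to the typed matrices
`BB.bb288.HXFlat/HZFlat` in `Census/BB/BB288Data.lean`): `C288.col J = colMask bb288HX J` (same check incidences) and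
`xorRows bb288HZ SEL288[i] = T288[i]` (every `T288` class is a `Z`-stabilizer class), plus the translation covariance
of the `H^Z` rows. Result `lowZ16_of_complete288`: the completeness statement proved by the tower (hypothesis here,
discharged in the closing file) gives the flat hypothesis `LowZ16` of
`Theorems/BB288DistanceCertificateLowerZOfFlat.lean`:
`∀ w, rowMatrix 288 bb288HX *ᵥ w = 0 → w ∉ rowSpace (rowMatrix 288 bb288HZ) → 16 < ‖w‖`.
-/

set_option maxRecDepth 100000
set_option exponentiation.threshold 512

namespace Summit.Ventures.QEC.Census.Fold.Tower

open Matrix Summit.Ventures.QEC.Census Summit.Ventures.QEC.Census.Fold Literature.InformationTheory.QuantumCodes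

/-! ## The span of the `H^Z` rows (numeral form) -/

/-- `u` is a XOR of `H^Z` rows of BB288. -/
def SpanZ (u : ℕ) : Prop := ∃ sel : List ℕ, (∀ i ∈ sel, i < 144) ∧ xorRows bb288HZ sel = u

/-- `xorList_map_eq_xorIdx`: xorList map eq xorIdx (auxiliary lemma of the fold-certificate soundness chain). -/
theorem xorList_map_eq_xorIdx {α : Type} (g : α → ℕ) (L : List α) : xorList (L.map g) = xorIdx g L := by
  induction L with
  | nil => rfl
  | cons a L ih => rw [List.map_cons, xorList, xorIdx, ih]

/-- the rows translate covariantly (generators). -/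
theorem hz_transX : ∀ i, i < 144 → transW 12 12 1 0 (bb288HZ.getD i 0) = bb288HZ.getD (transRow 12 12 1 0 i) 0 := by
  decide +kernel

/-- see `hz_transX`. -/
theorem hz_transY : ∀ i, i < 144 → transW 12 12 0 1 (bb288HZ.getD i 0) = bb288HZ.getD (transRow 12 12 0 1 i) 0 := by
  decide +kernel

/-- `transW_xorRows`: transW xorRows (auxiliary lemma of the fold-certificate soundness chain). -/
theorem transW_xorRows {da db : ℕ}
    (hrow : ∀ i, i < 144 → transW 12 12 da db (bb288HZ.getD i 0) = bb288HZ.getD (transRow 12 12 da db i) 0)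
    {sel : List ℕ} (hsel : ∀ i ∈ sel, i < 144) :
    transW 12 12 da db (xorRows bb288HZ sel) = xorRows bb288HZ (sel.map fun i => transRow 12 12 da db i) := by
  induction sel with
  | nil => simp [xorRows, xorList, transW]
  | cons a sel ih =>
    have ha := hsel a (by simp)
    have ih' := ih fun i hi => hsel i (by simp [hi])
    simp only [xorRows, List.map_cons, List.map_map, xorList] at *
    rw [transW_xor, hrow a ha, ih']

/-- `spanZ_gen`: spanZ gen (auxiliary lemma of the fold-certificate soundness chain). -/
theorem spanZ_gen {da db : ℕ}
    (hrow : ∀ i, i < 144 → transW 12 12 da db (bb288HZ.getD i 0) = bb288HZ.getD (transRow 12 12 da db i) 0)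
    {u : ℕ} (h : SpanZ u) : SpanZ (transW 12 12 da db u) := by
  obtain ⟨sel, hsel, rfl⟩ := h
  refine ⟨sel.map fun i => transRow 12 12 da db i, fun i hi => ?_, (transW_xorRows hrow hsel).symm⟩
  obtain ⟨j, _, rfl⟩ := List.mem_map.1 hi
  exact transRow_lt (by decide) (by decide) da db j

/-- every row is a 288-bit word. -/
theorem hz_lt : ∀ (i : ℕ) (hi : i < bb288HZ.length), bb288HZ[i] < 2 ^ (2 * (12 * 12)) := by decide +kernel

/-- `xorRows_hz_lt`: xorRows hz lt (auxiliary lemma of the fold-certificate soundness chain). -/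
theorem xorRows_hz_lt (sel : List ℕ) : xorRows bb288HZ sel < 2 ^ (2 * (12 * 12)) := by
  refine xorList_lt _ _ fun x hx => ?_
  obtain ⟨i, _, rfl⟩ := List.mem_map.1 hx
  by_cases hi : i < bb288HZ.length
  · rw [List.getD_eq_getElem _ _ hi]; exact hz_lt i hi
  · rw [List.getD_eq_default _ _ (Nat.le_of_not_lt hi)]; exact Nat.two_pow_pos _

/-- `SpanZ` is closed under all translations. -/
theorem spanZ_transW : ∀ (da db u : ℕ), SpanZ u → SpanZ (transW 12 12 da db u) := by
  have hX : ∀ da u, SpanZ u → SpanZ (transW 12 12 da 0 u) := by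
    intro da
    induction da with
    | zero =>
      intro u h; obtain ⟨sel, hsel, rfl⟩ := h
      exact ⟨sel, hsel, (transW_zero (by decide) (by decide) (xorRows_hz_lt sel)).symm⟩
    | succ d ih =>
      intro u h
      have := spanZ_gen hz_transX (ih u h)
      rwa [transW_transW (by decide) (by decide), Nat.add_comm 1 d] at this
  intro da db
  induction db with
  | zero => exact hX da
  | succ d ih =>
    intro u h
    have := spanZ_gen hz_transY (ih u h)
    rwa [transW_transW (by decide) (by decide), Nat.zero_add, Nat.add_comm 1 d] at this

/-- every `T288` class is in the `H^Z` span (kernel check of the selections). -/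
theorem t288_sel : ∀ i, i < 922 → xorRows bb288HZ (bitsOf 144 0 (SEL288.getD i 0)) = T288.getD i 0 := by
  decide +kernel

/-- `spanZ_of_mem`: spanZ of mem (auxiliary lemma of the fold-certificate soundness chain). -/
theorem spanZ_of_mem {r : ℕ} (hr : r ∈ T288) : SpanZ r := by
  obtain ⟨i, hi, rfl⟩ := List.mem_iff_getElem.1 hr
  have hlen : T288.length = 922 := by decide
  refine ⟨bitsOf 144 0 (SEL288.getD i 0), fun j hj => ?_, ?_⟩
  · have := mem_bitsOf_bound 144 0 _ j hj; omega
  · rw [t288_sel i (hlen ▸ hi), List.getD_eq_getElem _ _ hi]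

/-! ## The columns of `C288` are the certificate's `H^X` columns -/

/-- same check incidences as type-02's `bb288HX` (hence as `BB.bb288.HXFlat`). -/
theorem col288 : ∀ J, J < 288 → C288.col J = colMask bb288HX J := by decide +kernel

/-! ## The flat bound -/

/-- **TOP.** Completeness of `T288` for the weight `≤ 16` words of `ker H^X(C288)` gives: every `H^X`-kernel vector of
weight `≤ 16` lies in the row space of `H^Z` — the flat hypothesis `LowZ16`. -/
theorem lowZ16_of_complete288
    (complete288 : ∀ u, u < 2 ^ 288 → C288.ker 288 u → popc 288 u ≤ 16 → Matched 12 12 T288 u) :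
    ∀ w : Fin 288 → ZMod 2, rowMatrix 288 bb288HX *ᵥ w = 0 → w ∉ rowSpace (rowMatrix 288 bb288HZ) →
      16 < hammingNorm w := by
  intro w hw hnot
  by_contra hle
  rw [Nat.not_lt] at hle
  set J := suppIdx 288 w with hJ
  have hJb : ∀ j ∈ J, j < 288 := fun j hj => lt_of_mem_suppIdx 288 w hj
  set u := maskOf J with hu
  have hofBits : ofBits 288 u = w := by
    have := ofBits_xorFst_suppList 288 bb288HX w
    rwa [xorFst, suppList, List.map_map, show (Prod.fst ∘ fun j => (2 ^ j, colMask bb288HX j)) = fun j => 2 ^ j from rfl,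
      xorList_map_eq_xorIdx] at this
  have hult : u < 2 ^ 288 := maskOf_lt 288 J hJb
  have hpopc : popc 288 u = hammingNorm w := by rw [← hammingNorm_ofBits, hofBits]
  have hker : C288.ker 288 u := by
    unfold TCode.ker
    have h0 := xorSnd_suppList_eq_zero 288 bb288HX w hw
    rw [xorSnd, suppList, List.map_map, show (Prod.snd ∘ fun j => (2 ^ j, colMask bb288HX j)) = colMask bb288HX from rfl,
      xorList_map_eq_xorIdx, ← hJ] at h0
    rw [hu, ← xorIdx_eq_lin _ _ _ hJb, xorIdx_congr (h := colMask bb288HX) fun j hj => col288 j (hJb j hj)]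
    exact h0
  obtain ⟨r, hr, da, db, htr⟩ := complete288 u hult hker (hpopc ▸ hle)
  have hspan : SpanZ u := by
    have := spanZ_transW (12 - da % 12) (12 - db % 12) r (spanZ_of_mem hr)
    rwa [← htr, transW_inv (by decide) (by decide) hult] at this
  obtain ⟨sel, -, hsel⟩ := hspan
  apply hnot
  rw [← hofBits, ← hsel]
  exact ofBits_xorRows_mem_rowSpace 288 bb288HZ sel

end Summit.Ventures.QEC.Census.Fold.Tower
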